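import Summits.CriticalPhenomena.PercolationContinuityZ3.Theorems.PercNearOneGluingNoHeavyLowerTailAPLThreePointAll
import Summits.CriticalPhenomena.PercolationContinuityZ3.Theorems.PercNearOneGluingNoHeavyLowerTailAPLVwDVHardness
import Literature.Probability.Percolation.ClusterDeletionBound
import HarnessLib

/-!
# `NoHeavyLowerTail` (stmt-CriticalPhenomena-4575) — the ATTACHMENT FORM of the three-point covariance:
# `P(u↔v) − P(u↔v off o) ≤ P(o↔u)·P(o↔v)`, i.e. `κ + m ≤ s_off`, i.e. `κ ≤ P(u↔v off o, o↔u)`,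
# and the rigorous regime bounds of the `E`-route (`E := κ²/(Pm)`)

Support file (prover prim-ineq-gen-8 gen 57; `--supports stmt-CriticalPhenomena-4575`; memo
run/shared/lean/prim/prim-ineq-gen-8/FINDING-gen57-EROUTE.md).  No definitions, no named facts, no sorries.

`μ = prodBernoulli w` on the pairs of a finite vertex type `V`; notation of the lineage for an apex `o` and ports `u, v`:
`p = μ(o↔u)`, `π = μ(o↔v)`, `τ = μ(o↔u ∩ o↔v)`, `s = μ(u↔v)`, `P = pπ`, `κ = τ − P ≥ 0` (Harris), `m = s − τ = μ(u↔v ∩ (o↔u)ᶜ)`,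
`s_off = μ(u↔v in V∖{o})` (ports joined OFF the apex), `τ₁ = μ(u↔v in V∖{o} ∩ o↔u) = s_off − m` (ports joined off the apex AND the
apex attached to their common cluster), `Θ = τ₁/s_off`, `T = τ/P`, `E = κ²/(Pm)`.
* **`apexBypass`** — `s − s_off ≤ pπ`: the apex can add at most `P(o↔u)P(o↔v)` to the `u–v` connection.  This is the
  one-vertex case `C = {o}` of the cluster-deletion cost bound `P(z↔x) − P(z↔x in Cᶜ) ≤ Σ_{c∈C} P(z↔c)P(c↔x)`
  (`Literature.Probability.Percolation.real_openConn_sub_openConnIn_compl_le_sum`: Aizenman–Newman 1984; Panis–Schapira (3.8));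
  `{u↔v} ∖ {u↔v off o} ⊆ {o↔u} □ {o↔v}` and BK.  Used since gen 55 of the lineage (memo FINDING-gen55 §0(7)) without a kernel entry.
* **`conn_inter_notApex_eq`** — the event identity `{u↔v} ∩ {o↔u}ᶜ = {u↔v off o} ∩ {o↔u}ᶜ` (so `m = (1−Θ)·s_off`);
  the companion `{u↔v} ∩ {o↔u} = {o↔u} ∩ {o↔v}` is `openConn_vx_inter_sv` (`…APLVwDVHardness.lean`).
* **`kappa_le_attach`** — the covariance form `κ ≤ τ₁`: `μ(o↔u ∩ o↔v) − μ(o↔u)μ(o↔v) ≤ μ(u↔v off o ∩ o↔u)`.  With `m = (1−Θ)s_off`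
  this is `κ/m ≤ Θ/(1−Θ)` and `E·(1−Θ) ≤ Θ·(T−1)`; with (★★₃) (`threePoint_all`: `κ² ≤ Pκ + 3Pm`, i.e. `E ≤ 3 + κ/m`) it gives the
  rigorous part of the regime analysis of Conjecture E (`κ² ≤ C·P·m`): `E ≤ 3 + Θ/(1−Θ)`.
* **`T_le_of_m_le_kappa`** — in the corner regime `m ≤ κ` one has `τ² ≤ 6·P·τ − 3·P²` (`T ≤ 3 + √6`), from `gladkov3_all`.
[this work]
-/

noncomputable section

namespace Summit.CriticalPhenomena.PercolationContinuityZ3.Theorems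

namespace APL

open MeasureTheory Set Literature.Probability.Percolation Literature.Probability.LatticeModels
open scoped Classical

variable {V : Type*}

/-! ### Event identities -/

/-- An open walk avoiding `o` witnesses `{x ↔ y in V∖{o}}` (Mathlib's `SimpleGraph.Walk.induce`). [folklore] -/
private theorem openConnIn_compl_of_walk {ω : BondConfig V} {o x y : V} (q : (openGraph ω).Walk x y)
    (h : o ∉ q.support) : ω ∈ openConnIn (({o} : Set V)ᶜ) x y := by
  have hS : ∀ z ∈ q.support, z ∈ (({o} : Set V)ᶜ) := by
    intro z hz
    rw [mem_compl_iff, mem_singleton_iff]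
    rintro rfl
    exact h hz
  exact ⟨hS x q.start_mem_support, hS y q.end_mem_support, ⟨q.induce _ hS⟩⟩

/-- **`m = (1 − Θ)·s_off` as events**: `{u↔v} ∩ {o↔u}ᶜ = {u↔v in V∖{o}} ∩ {o↔u}ᶜ` — if `u ↔ v` but `o ↮ u`, no open `u–v` path
visits `o`. [folklore] -/
theorem conn_inter_notApex_eq (o u v : V) :
    (openConn u v : Set (BondConfig V)) ∩ (openConn o u : Set (BondConfig V))ᶜ =
      (openConnIn (({o} : Set V)ᶜ) u v : Set (BondConfig V)) ∩ (openConn o u : Set (BondConfig V))ᶜ := by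
  ext ω
  simp only [mem_inter_iff, mem_compl_iff]
  constructor
  · rintro ⟨huv, hou⟩
    refine ⟨?_, hou⟩
    obtain ⟨q⟩ := huv
    refine openConnIn_compl_of_walk q fun ho => hou ?_
    -- `o` on an open `u–v` walk is joined to `u`
    exact SimpleGraph.Reachable.symm ⟨q.takeUntil o ho⟩
  · rintro ⟨huv, hou⟩
    exact ⟨openConnIn_subset_openConn _ u v huv, hou⟩

/-! ### The attachment form -/

section Measure

variable [Fintype V]

/-- **Apex bypass / attachment form `s − s_off ≤ pπ`**: for every finite weighted graph and all `o, u, v`,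
`μ(u↔v) − μ(u↔v in V∖{o}) ≤ μ(o↔u)·μ(o↔v)` — the case `C = {o}` of the cluster-deletion cost bound
(`{u↔v} ∖ {u↔v off o} ⊆ {u↔o} □ {o↔v}` and BK). [cite: AizenmanNewman1984, §4] -/
theorem apexBypass (w : Sym2 V → unitInterval) (o u v : V) :
    (prodBernoulli w).real (openConn u v : Set (BondConfig V)) -
        (prodBernoulli w).real (openConnIn (({o} : Set V)ᶜ) u v : Set (BondConfig V)) ≤
      (prodBernoulli w).real (openConn o u : Set (BondConfig V)) *
        (prodBernoulli w).real (openConn o v : Set (BondConfig V)) := by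
  have h := real_openConn_sub_openConnIn_compl_le_sum w ({o} : Finset V) u v
  have huo : (openConn u o : Set (BondConfig V)) = openConn o u := by
    ext ω
    exact ⟨fun hω => SimpleGraph.Reachable.symm hω, fun hω => SimpleGraph.Reachable.symm hω⟩
  rw [Finset.sum_singleton, Finset.coe_singleton, huo] at h
  exact h

/-- **Covariance form `κ ≤ τ₁`**: `μ(o↔u ∩ o↔v) − μ(o↔u)·μ(o↔v) ≤ μ(u↔v in V∖{o} ∩ o↔u)` — the covariance of `{o↔u}` and
`{o↔v}` is at most the probability that the ports are joined off the apex AND the apex is attached to their cluster.  Equivalently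
`κ + m ≤ s_off`; with `m = (1−Θ)s_off` (`conn_inter_notApex_eq`): `κ/m ≤ Θ/(1−Θ)` and `E(1−Θ) ≤ Θ(T−1)`. [this work] -/
theorem kappa_le_attach (w : Sym2 V → unitInterval) (o u v : V) :
    (prodBernoulli w).real ((openConn o u : Set (BondConfig V)) ∩ (openConn o v : Set (BondConfig V))) -
        (prodBernoulli w).real (openConn o u : Set (BondConfig V)) *
          (prodBernoulli w).real (openConn o v : Set (BondConfig V)) ≤
      (prodBernoulli w).real ((openConnIn (({o} : Set V)ᶜ) u v : Set (BondConfig V)) ∩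
        (openConn o u : Set (BondConfig V))) := by
  set μ := prodBernoulli w with hμ
  set A : Set (BondConfig V) := openConn o u with hA
  set B : Set (BondConfig V) := openConn o v with hB
  set S : Set (BondConfig V) := openConn u v with hS
  set I : Set (BondConfig V) := openConnIn (({o} : Set V)ᶜ) u v with hI
  have hbyp : μ.real S - μ.real I ≤ μ.real A * μ.real B := apexBypass w o u v
  -- `μ(I) = μ(I ∩ A) + μ(I ∩ Aᶜ)` and `μ(S) = μ(S ∩ A) + μ(S ∩ Aᶜ)`
  have hI2 : μ.real (I ∩ A) + μ.real (I \ A) = μ.real I :=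
    measureReal_inter_add_sdiff (s := I) MeasurableSet.of_discrete (measure_ne_top _ _)
  have hS2 : μ.real (S ∩ A) + μ.real (S \ A) = μ.real S :=
    measureReal_inter_add_sdiff (s := S) MeasurableSet.of_discrete (measure_ne_top _ _)
  -- `S ∩ Aᶜ = I ∩ Aᶜ` and `S ∩ A = A ∩ B`
  have h1 : S \ A = I \ A := by
    rw [Set.sdiff_eq, Set.sdiff_eq, hS, hA, hI]
    exact conn_inter_notApex_eq o u v
  have h2 : S ∩ A = A ∩ B := by
    rw [hS, hA, hB]
    exact openConn_vx_inter_sv o u v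
  rw [h1] at hS2
  rw [h2] at hS2
  linarith

/-- **The corner regime forces `T ≤ 3 + √6`**: if `m ≤ κ`, i.e. `μ(u↔v) − τ ≤ τ − μ(o↔u)μ(o↔v)`, then
`τ² ≤ 6·P·τ − 3·P²` (`P = μ(o↔u)μ(o↔v)`, `τ = μ(o↔u ∩ o↔v)`), from `gladkov3_all` (`τ² ≤ 3·P·μ(u↔v)`). [this work] -/
theorem T_le_of_m_le_kappa (w : Sym2 V → unitInterval) (o u v : V)
    (h : (prodBernoulli w).real (openConn u v : Set (BondConfig V)) -
        (prodBernoulli w).real ((openConn o u : Set (BondConfig V)) ∩ (openConn o v : Set (BondConfig V))) ≤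
      (prodBernoulli w).real ((openConn o u : Set (BondConfig V)) ∩ (openConn o v : Set (BondConfig V))) -
        (prodBernoulli w).real (openConn o u : Set (BondConfig V)) * (prodBernoulli w).real (openConn o v : Set (BondConfig V))) :
    (prodBernoulli w).real ((openConn o u : Set (BondConfig V)) ∩ (openConn o v : Set (BondConfig V))) ^ 2 ≤
      6 * ((prodBernoulli w).real (openConn o u : Set (BondConfig V)) * (prodBernoulli w).real (openConn o v : Set (BondConfig V))) *
          (prodBernoulli w).real ((openConn o u : Set (BondConfig V)) ∩ (openConn o v : Set (BondConfig V))) -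
        3 * ((prodBernoulli w).real (openConn o u : Set (BondConfig V)) * (prodBernoulli w).real (openConn o v : Set (BondConfig V))) ^ 2 := by
  have hg := gladkov3_all w o u v
  have hP0 : 0 ≤ (prodBernoulli w).real (openConn o u : Set (BondConfig V)) * (prodBernoulli w).real (openConn o v : Set (BondConfig V)) :=
    mul_nonneg measureReal_nonneg measureReal_nonneg
  nlinarith [mul_le_mul_of_nonneg_left h hP0]

end Measure

end APL

end Summit.CriticalPhenomena.PercolationContinuityZ3.Theorems

end
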